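import Summits.CriticalPhenomena.PercolationContinuityZ3.Theorems.Transplant.SqShadowLinkageNode
import Summits.CriticalPhenomena.PercolationContinuityZ3.Theorems.Transplant.DiamondFilmQuarterTurn
import Summits.CriticalPhenomena.PercolationContinuityZ3.Theorems.Transplant.DiamondFilmOwnCriticalContinuityHolds
import Summits.CriticalPhenomena.PercolationContinuityZ3.Theorems.Transplant.StatementObliqueFilms
import HarnessLib

/-!
# The EVEN diamond `(001)`-films `D_{2m}` carry a SQUARE SHADOW: the instance `DiamondFilm.sqShadow`, Burton–Keane uniqueness for the films, and
# **`DiamondFilmOwnCriticalContinuity k` (k even, ≥ 2) MODULO THE LOCAL ROUTING NODE ALONE** — p205010-free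

builds on p205010 (kernel theorem, internal audit signed; external expert review pending) — NOT used: the by-name closure `diamondFilmOwnCriticalContinuity_holds` goes through
p205010; this file only imports its module for the elementary scope facts `DiamondFilm.connected`, `DiamondFilm.finite_reps` (declaration cones p205010-free).
Lane `prim-bschramm`, seat `prim-bschramm-p2` (gen 42; class C1b = films at their own critical point, METHOD = input substitution; memo `HOME/bschramm/P2-LATTICES.md` §148); helper file
(`--supports stmt-CriticalPhenomena-4575 --as helper`).

THE INSTANCE.  `D_k = diamondGraph.induce (diamondFilm k)` with the planar shadow `uv = ((x₀+x₁)/2, (x₀−x₁)/2)` («DiamondFilmQuarterTurn»): bonds are unit axis steps (`uv_step`), columns are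
finite (a column is a segment of heights `0..k`), the translations by `(2(t₀+t₁), 2(t₀−t₁), 0)` lift the shadow translations by `2•t` (period `2`), the QUARTER TURN ∘ LEVEL FLIP
`rotFlipIso` (EVEN `k` only) lifts the quarter turn about `centre = (0, c_k/2)` (`uv_rotFlip`), and the coordinate swap `x₀ ↔ x₁` composed with the translation by `(c_k, −c_k, 0)` (shadow translation `(0, c_k)`) lifts
the mirror about that centre.  Hence **`DiamondFilm.sqShadow (hk : Even k) : SqShadow (D_k)`**.  Scope: `D_k` is connected (`k ≥ 2`), quasi-transitive and of quadratic growth, hence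
amenable, so Burton–Keane gives a.s. uniqueness of the infinite cluster at every density (`numInfiniteClusters_le_one`).  With the square DST layer («SqShadow*», gens 42):
**`diamondFilmOwnCriticalContinuity_of_localLinkage`** / **`_of_shapedLinkage`**: for even `k ≥ 2`, the purely local routing certificate for the shadow of `D_k` gives
`DiamondFilmOwnCriticalContinuity k` — the residue of TARGET 2x for even thickness, p205010-free, modulo a finite combinatorial check of the instance.
[cite: DuminilCopinSidoraviciusTassion2016, Thm. 1 and §2; p. 2 "Two generalizations"] [cite: ConwaySloane1999, Ch. 4 §7.3] [cite: BurtonKeane1989, Thm. 2] [cite: BenjaminiSchramm1996, Conj. 4 / Question 3]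
-/

noncomputable section

namespace Summit.CriticalPhenomena.PercolationContinuityZ3.Theorems.Transplant

open MeasureTheory Literature.Probability.Percolation Literature.Probability.LatticeModels SimpleGraph Filter
open Literature.Barriers.CriticalPhenomena (IsQuasiTransitive IsGraphAmenable HasExponentialGrowth graphBall ballVolume graphBall_finite
  BurtonKeane1989_atMostOneInfiniteCluster_holds hasExponentialGrowth_of_not_isGraphAmenable)
open scoped Classical Topology

namespace DiamondFilm

variable {k : ℕ}

/-! ## §1 Two more automorphisms of `D_k`: the coordinate swap and the horizontal translations -/

/-- The coordinate swap `(x₀, x₁, x₂) ↦ (x₁, x₀, x₂)` on film vertices. [cite: ConwaySloane1999, Ch. 4 §7.3] -/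
def swapV (x : diamondFilm k) : diamondFilm k :=
  ⟨⟨![crd x 1, crd x 0, crd x 2], by
    obtain ⟨h0, h1, h2, -, -⟩ := crd_facts x
    rw [mem_diamondSite_iff]
    simp only [Matrix.cons_val_zero, Matrix.cons_val_one, Matrix.cons_val_two, Matrix.tail_cons, Matrix.head_cons]
    refine ⟨h1, h0, ?_⟩; rwa [add_comm (crd x 1) (crd x 0)]⟩, by
    obtain ⟨-, -, -, h3, h4⟩ := crd_facts x
    rw [mem_diamondFilm]; exact ⟨h3, h4⟩⟩

/-- Coordinates of the swap. [folklore] -/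
theorem crd_swapV (x : diamondFilm k) : crd (swapV x) 0 = crd x 1 ∧ crd (swapV x) 1 = crd x 0 ∧ crd (swapV x) 2 = crd x 2 := ⟨rfl, rfl, rfl⟩

/-- The swap is an involution. [folklore] -/
theorem swapV_swapV (x : diamondFilm k) : swapV (swapV x) = x := by
  apply ext_crd; intro i
  obtain ⟨a0, a1, a2⟩ := crd_swapV (swapV x)
  obtain ⟨b0, b1, b2⟩ := crd_swapV x
  fin_cases i
  · show crd (swapV (swapV x)) 0 = crd x 0; rw [a0, b1]
  · show crd (swapV (swapV x)) 1 = crd x 1; rw [a1, b0]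
  · show crd (swapV (swapV x)) 2 = crd x 2; rw [a2, b2]

/-- **The coordinate swap is a graph automorphism of `D_k`.** [cite: ConwaySloane1999, Ch. 4 §7.3] -/
def swapIso (k : ℕ) : diamondGraph.induce (diamondFilm k) ≃g diamondGraph.induce (diamondFilm k) where
  toEquiv := ⟨swapV, swapV, swapV_swapV, swapV_swapV⟩
  map_rel_iff' := by
    intro x y
    show (diamondGraph.induce (diamondFilm k)).Adj (swapV x) (swapV y) ↔ (diamondGraph.induce (diamondFilm k)).Adj x y
    obtain ⟨a0, a1, a2⟩ := crd_swapV x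
    obtain ⟨b0, b1, b2⟩ := crd_swapV y
    rw [adj_crd_iff, adj_crd_iff, a0, a1, a2, b0, b1, b2]
    tauto

/-- The swap acts on the shadow by the mirror `(u, v) ↦ (u, −v)`. [folklore] -/
theorem uv_swapV (x : diamondFilm k) : uv (swapV x) 0 = uv x 0 ∧ uv (swapV x) 1 = -uv x 1 := by
  obtain ⟨px0, px1, -, -, -⟩ := crd_facts x
  obtain ⟨a0, a1, -⟩ := crd_swapV x
  obtain ⟨ex0, ex1⟩ := uv_apply x
  obtain ⟨fx0, fx1⟩ := uv_apply (swapV x)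
  rw [fx0, fx1, ex0, ex1, a0, a1]
  constructor <;> omega

/-- The translation by `(2(t₀ + t₁), 2(t₀ − t₁), 0)` on film vertices (it preserves the parities, the residue of `x₀+x₁+x₂ mod 4`, and the height).
[cite: ConwaySloane1999, Ch. 4 §7.3] -/
def translV (t : Site 2) (x : diamondFilm k) : diamondFilm k :=
  ⟨⟨![crd x 0 + 2 * (t 0 + t 1), crd x 1 + 2 * (t 0 - t 1), crd x 2], by
    obtain ⟨h0, h1, h2, -, -⟩ := crd_facts x
    rw [mem_diamondSite_iff]
    simp only [Matrix.cons_val_zero, Matrix.cons_val_one, Matrix.cons_val_two, Matrix.tail_cons, Matrix.head_cons]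
    omega⟩, by
    obtain ⟨-, -, -, h3, h4⟩ := crd_facts x
    rw [mem_diamondFilm]; exact ⟨h3, h4⟩⟩

/-- Coordinates of the translation. [folklore] -/
theorem crd_translV (t : Site 2) (x : diamondFilm k) :
    crd (translV t x) 0 = crd x 0 + 2 * (t 0 + t 1) ∧ crd (translV t x) 1 = crd x 1 + 2 * (t 0 - t 1) ∧ crd (translV t x) 2 = crd x 2 := ⟨rfl, rfl, rfl⟩

/-- Translating by `t` and then by `−t` is the identity. [folklore] -/
theorem translV_neg_translV (t : Site 2) (x : diamondFilm k) : translV (-t) (translV t x) = x := by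
  apply ext_crd; intro i
  obtain ⟨a0, a1, a2⟩ := crd_translV (-t) (translV t x)
  obtain ⟨b0, b1, b2⟩ := crd_translV t x
  simp only [Pi.neg_apply] at a0 a1
  fin_cases i
  · show crd (translV (-t) (translV t x)) 0 = crd x 0; omega
  · show crd (translV (-t) (translV t x)) 1 = crd x 1; omega
  · show crd (translV (-t) (translV t x)) 2 = crd x 2; omega

/-- **The horizontal translations are graph automorphisms of `D_k`.** [cite: ConwaySloane1999, Ch. 4 §7.3] -/
def translIso (k : ℕ) (t : Site 2) : diamondGraph.induce (diamondFilm k) ≃g diamondGraph.induce (diamondFilm k) where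
  toEquiv := ⟨translV t, translV (-t), translV_neg_translV t, fun x => by simpa using translV_neg_translV (-t) x⟩
  map_rel_iff' := by
    intro x y
    show (diamondGraph.induce (diamondFilm k)).Adj (translV t x) (translV t y) ↔ (diamondGraph.induce (diamondFilm k)).Adj x y
    obtain ⟨a0, a1, a2⟩ := crd_translV t x
    obtain ⟨b0, b1, b2⟩ := crd_translV t y
    rw [adj_crd_iff, adj_crd_iff, a0, a1, a2, b0, b1, b2]
    constructor
    · rintro ⟨h0, h1, h2⟩; refine ⟨?_, ?_, h2⟩ <;> omega
    · rintro ⟨h0, h1, h2⟩; refine ⟨?_, ?_, h2⟩ <;> omega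

/-- The translation acts on the shadow by `uv ↦ uv + 2•t`. [folklore] -/
theorem uv_translV (t : Site 2) (x : diamondFilm k) : uv (translV t x) = uv x + (2 : ℤ) • t := by
  obtain ⟨px0, px1, -, -, -⟩ := crd_facts x
  obtain ⟨a0, a1, -⟩ := crd_translV t x
  obtain ⟨ex0, ex1⟩ := uv_apply x
  obtain ⟨fx0, fx1⟩ := uv_apply (translV t x)
  ext i; fin_cases i
  · show uv (translV t x) 0 = (uv x + (2 : ℤ) • t) 0
    rw [Pi.add_apply, Pi.smul_apply, smul_eq_mul, fx0, ex0, a0, a1]; omega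
  · show uv (translV t x) 1 = (uv x + (2 : ℤ) • t) 1
    rw [Pi.add_apply, Pi.smul_apply, smul_eq_mul, fx1, ex1, a0, a1]; omega

/-! ## §2 The square shadow of `D_k`, `k` even -/

/-- The shadow determines `x₀` and `x₁`. [folklore] -/
theorem crd_eq_of_uv (x : diamondFilm k) : crd x 0 = uv x 0 + uv x 1 ∧ crd x 1 = uv x 0 - uv x 1 := by
  obtain ⟨px0, px1, -, -, -⟩ := crd_facts x
  obtain ⟨ex0, ex1⟩ := uv_apply x
  rw [ex0, ex1]; constructor <;> omega

/-- **Columns are finite**: a column of the shadow is a set of film vertices with prescribed `x₀, x₁` and `0 ≤ x₂ ≤ k`. [folklore] -/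
theorem fibre_finite (k : ℕ) (z : Site 2) : {x : diamondFilm k | uv x = z}.Finite := by
  refine Set.Finite.of_finite_image (f := fun x : diamondFilm k => crd x 2) ?_ ?_
  · exact (Set.finite_Icc (0 : ℤ) k).subset (by
      rintro _ ⟨x, -, rfl⟩
      obtain ⟨-, -, -, h3, h4⟩ := crd_facts x
      exact ⟨h3, h4⟩)
  · intro x hx y hy h
    rw [Set.mem_setOf_eq] at hx hy
    have ex := crd_eq_of_uv x
    have ey := crd_eq_of_uv y
    rw [hx] at ex; rw [hy] at ey
    apply ext_crd; intro i; fin_cases i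
    · show crd x 0 = crd y 0; rw [ex.1, ey.1]
    · show crd x 1 = crd y 1; rw [ex.2, ey.2]
    · exact h

/-- **Bonds of `D_k` project to bonds of `ℤ²`** (`uv_step` in graph form). [cite: ConwaySloane1999, Ch. 4 §7.3] -/
theorem uv_lip {x y : diamondFilm k} (h : (diamondGraph.induce (diamondFilm k)).Adj x y) : uv x = uv y ∨ (zdGraph 2).Adj (uv x) (uv y) := by
  right
  rw [zdGraph_adj_iff]
  rcases uv_step h with ⟨h1, h0 | h0⟩ | ⟨h0, h1 | h1⟩
  · refine ⟨0, Or.inr ?_⟩; ext i; fin_cases i <;> simp <;> omega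
  · refine ⟨0, Or.inl ?_⟩; ext i; fin_cases i <;> simp <;> omega
  · refine ⟨1, Or.inr ?_⟩; ext i; fin_cases i <;> simp <;> omega
  · refine ⟨1, Or.inl ?_⟩; ext i; fin_cases i <;> simp <;> omega

/-- The centre of square symmetry of the shadow: `(0, c_k/2)`. [folklore] -/
def sqCentre (k : ℕ) : Site 2 := ![0, shift k / 2]

/-- **THE SQUARE SHADOW OF THE EVEN DIAMOND FILM `D_k`**: shadow `uv`, period `2`, centre `(0, c_k/2)`; the quarter turn lifts to `rotFlipIso`, the mirror to the coordinate swap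
composed with a translation. [cite: DuminilCopinSidoraviciusTassion2016, Notation p. 3 and §2] [cite: ConwaySloane1999, Ch. 4 §7.3] -/
def sqShadow (hk : Even k) : SqShadow (diamondGraph.induce (diamondFilm k)) where
  sh := uv
  lip := fun _ _ h => uv_lip h
  fibre := fibre_finite k
  period := 2
  period_pos := by norm_num
  centre := sqCentre k
  shift := fun t => ⟨translIso k t, fun w => by
    show uv (translV t w) = uv w + ((2 : ℕ) : ℤ) • t
    rw [uv_translV]; rfl⟩
  rot := ⟨rotFlipIso hk, fun w => by
    show uv (rotFlip hk w) - sqCentre k = sqRot90 (uv w - sqCentre k)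
    obtain ⟨h0, h1⟩ := uv_rotFlip hk w
    ext i; fin_cases i
    · show (uv (rotFlip hk w) - sqCentre k) 0 = sqRot90 (uv w - sqCentre k) 0
      simp only [Pi.sub_apply, sqRot90_apply_zero, sqCentre, Matrix.cons_val_zero, Matrix.cons_val_one, h0]; ring
    · show (uv (rotFlip hk w) - sqCentre k) 1 = sqRot90 (uv w - sqCentre k) 1
      simp only [Pi.sub_apply, sqRot90_apply_one, sqCentre, Matrix.cons_val_zero, Matrix.cons_val_one, h1]; ring⟩
  refl := ⟨(swapIso k).trans (translIso k ![0, shift k / 2]), fun w => by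
    show uv (translV ![0, shift k / 2] (swapV w)) - sqCentre k = sqFlip (uv w - sqCentre k)
    rw [uv_translV]
    obtain ⟨h0, h1⟩ := uv_swapV w
    ext i; fin_cases i
    · show (uv (swapV w) + (2 : ℤ) • ![0, shift k / 2] - sqCentre k) 0 = sqFlip (uv w - sqCentre k) 0
      simp only [Pi.sub_apply, Pi.add_apply, Pi.smul_apply, smul_eq_mul, sqFlip_apply_zero, sqCentre, Matrix.cons_val_zero, h0]; ring
    · show (uv (swapV w) + (2 : ℤ) • ![0, shift k / 2] - sqCentre k) 1 = sqFlip (uv w - sqCentre k) 1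
      simp only [Pi.sub_apply, Pi.add_apply, Pi.smul_apply, smul_eq_mul, sqFlip_apply_one, sqCentre, Matrix.cons_val_zero, Matrix.cons_val_one, h1]; ring⟩

/-- The shadow map of the instance is `uv`. [folklore] -/
@[simp] theorem sqShadow_sh (hk : Even k) : (sqShadow hk).sh = uv := rfl

/-! ## §3 Scope: quasi-transitivity, quadratic growth, amenability, uniqueness of the infinite cluster -/

/-- **`D_k` is quasi-transitive** (the horizontal translations by `4ℤ²` have finitely many orbits: representatives in `[0,4)² × [0,k]`). [cite: LyonsPeres2016, §7.4] -/
theorem isQuasiTransitive (k : ℕ) : IsQuasiTransitive (diamondGraph.induce (diamondFilm k)) := by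
  refine ⟨(finite_reps k).toFinset, fun x => ?_⟩
  set q0 : ℤ := crd x 0 / 4 with hq0
  set q1 : ℤ := crd x 1 / 4 with hq1
  refine ⟨translIso k ![-q0 - q1, -q0 + q1], ?_⟩
  rw [Set.Finite.mem_toFinset, Set.mem_setOf_eq]
  obtain ⟨a0, a1, -⟩ := crd_translV (![-q0 - q1, -q0 + q1] : Site 2) x
  show 0 ≤ crd (translV ![-q0 - q1, -q0 + q1] x) 0 ∧ crd (translV ![-q0 - q1, -q0 + q1] x) 0 < 4 ∧
    0 ≤ crd (translV ![-q0 - q1, -q0 + q1] x) 1 ∧ crd (translV ![-q0 - q1, -q0 + q1] x) 1 < 4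
  rw [a0, a1]
  simp only [Matrix.cons_val_zero, Matrix.cons_val_one]
  omega

/-- Along a walk of `D_k` of length `n` the coordinates `x₀, x₁` move by at most `n`. [folklore] -/
theorem abs_sub_le_length {x y : diamondFilm k} (w : (diamondGraph.induce (diamondFilm k)).Walk x y) (i : Fin 2) :
    |crd y (Fin.castSucc i) - crd x (Fin.castSucc i)| ≤ (w.length : ℤ) := by
  induction w with
  | nil => simp
  | @cons a b c hab w ih =>
    have h1 : |crd b (Fin.castSucc i) - crd a (Fin.castSucc i)| ≤ 1 := by
      have := (adj_iff_crd a b).1 hab (Fin.castSucc i)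
      rw [abs_le]; omega
    have h2 : |crd c (Fin.castSucc i) - crd a (Fin.castSucc i)| ≤ |crd c (Fin.castSucc i) - crd b (Fin.castSucc i)| + |crd b (Fin.castSucc i) - crd a (Fin.castSucc i)| := by
      have := abs_sub_le (crd c (Fin.castSucc i)) (crd b (Fin.castSucc i)) (crd a (Fin.castSucc i)); linarith
    simp only [SimpleGraph.Walk.length_cons, Nat.cast_add, Nat.cast_one]
    linarith

/-- **Quadratic growth**: `|B(x,n)| ≤ (2n+1)²·(k+1)`. [cite: LyonsPeres2016, §6.1 (growth of balls)] -/
theorem ballVolume_le (x : diamondFilm k) (n : ℕ) : ballVolume (diamondGraph.induce (diamondFilm k)) x n ≤ (2 * n + 1) ^ 2 * (k + 1) := by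
  set f : diamondFilm k → ℤ × ℤ × ℤ := fun y => (crd y 0 - crd x 0, crd y 1 - crd x 1, crd y 2) with hf
  have hinj : Function.Injective f := by
    intro y z h
    simp only [hf, Prod.mk.injEq] at h
    apply ext_crd; intro i; fin_cases i
    · show crd y 0 = crd z 0; omega
    · show crd y 1 = crd z 1; omega
    · exact h.2.2
  set S : Finset (ℤ × ℤ × ℤ) := Finset.Icc (-(n : ℤ)) n ×ˢ (Finset.Icc (-(n : ℤ)) n ×ˢ Finset.Icc (0 : ℤ) k) with hS
  have hsub : f '' graphBall (diamondGraph.induce (diamondFilm k)) x n ⊆ ↑S := by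
    rintro _ ⟨y, ⟨w, hw⟩, rfl⟩
    have h0 := abs_sub_le_length w 0
    have h1 := abs_sub_le_length w 1
    simp only [Fin.castSucc_zero] at h0
    have e1 : Fin.castSucc (1 : Fin 2) = (1 : Fin 3) := rfl
    rw [e1] at h1
    have hn : (w.length : ℤ) ≤ n := by exact_mod_cast hw
    obtain ⟨-, -, -, h3, h4⟩ := crd_facts y
    rw [abs_le] at h0 h1
    simp only [hS, hf, Finset.coe_product, Finset.coe_Icc, Set.mem_prod, Set.mem_Icc]
    refine ⟨⟨?_, ?_⟩, ⟨?_, ?_⟩, h3, h4⟩ <;> linarith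
  have hcard : S.card = (2 * n + 1) ^ 2 * (k + 1) := by
    rw [hS, Finset.card_product, Finset.card_product, Int.card_Icc, Int.card_Icc]
    have e1 : ((n : ℤ) + 1 - -(n : ℤ)).toNat = 2 * n + 1 := by omega
    have e2 : ((k : ℤ) + 1 - 0).toNat = k + 1 := by omega
    rw [e1, e2]; ring
  unfold ballVolume
  rw [← Set.ncard_image_of_injective _ hinj, ← hcard, ← Set.ncard_coe_finset]
  exact Set.ncard_le_ncard hsub S.finite_toSet

/-- `D_k` does not have exponential growth. [cite: Hutchcroft2016, §1 (exponential growth)] -/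
theorem not_hasExponentialGrowth (k : ℕ) : ¬ HasExponentialGrowth (diamondGraph.induce (diamondFilm k)) := by
  intro h
  obtain ⟨c, hc, hev⟩ := h (diamondFilmOrigin k)
  have hev2 := Literature.Barriers.CriticalPhenomena.eventually_pow_lt_const_pow 3 hc
  obtain ⟨n, ⟨hn1, hn2⟩, hnk⟩ := ((hev.and hev2).and (eventually_ge_atTop k)).exists
  have hvol : (ballVolume (diamondGraph.induce (diamondFilm k)) (diamondFilmOrigin k) n : ℝ) ≤ (2 * n + 1) ^ 2 * (k + 1) := by
    exact_mod_cast ballVolume_le (diamondFilmOrigin k) n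
  have hk' : ((k : ℝ) + 1) ≤ 2 * n + 1 := by
    have : (k : ℝ) ≤ n := by exact_mod_cast hnk
    linarith
  have hle : ((2 * n + 1 : ℝ)) ^ 2 * (k + 1) ≤ (2 * n + 1) ^ 3 := by
    rw [pow_succ]
    exact mul_le_mul_of_nonneg_left hk' (sq_nonneg _)
  linarith

/-- **`D_k` is amenable** (subexponential growth + quasi-transitivity). [cite: LyonsPeres2016, §6.1 (p. 279)] -/
theorem isGraphAmenable (k : ℕ) : IsGraphAmenable (diamondGraph.induce (diamondFilm k)) := by
  by_contra h
  exact not_hasExponentialGrowth k (hasExponentialGrowth_of_not_isGraphAmenable _ (isQuasiTransitive k) h)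

/-- **Uniqueness of the infinite cluster on `D_k` (`k ≥ 2`), every density** (Burton–Keane). [cite: BurtonKeane1989, Thm. 2] [cite: LyonsPeres2016, Thm. 7.6] -/
theorem numInfiniteClusters_le_one (hk : 2 ≤ k) (p : unitInterval) :
    ∀ᵐ ω ∂(bondPercolation (diamondGraph.induce (diamondFilm k)) p), numInfiniteClusters ω ≤ 1 :=
  BurtonKeane1989_atMostOneInfiniteCluster_holds _ (connected hk) (isQuasiTransitive k) (isGraphAmenable k) p

/-! ## §4 The even films at their own critical point, modulo the local routing node alone -/

/-- **`DiamondFilmOwnCriticalContinuity k` FOR EVEN `k ≥ 2` FROM LOCAL LINKAGE of the square shadow** — Duminil-Copin–Sidoravicius–Tassion's proof transplanted to the film `D_k` (square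
DST layer «SqShadow*»: eq. (1), Lemmata 4–7, eqs. (10)–(13), §2.2, Facts 1–2 PROVED; the instance supplies connectedness, uniqueness — §3 — and the local routing certificate
`LocalLinkage`).  Independent of p205010. [cite: DuminilCopinSidoraviciusTassion2016, Thm. 1 and §2] [cite: BenjaminiSchramm1996, Conj. 4 / Question 3] -/
theorem diamondFilmOwnCriticalContinuity_of_localLinkage (hk2 : 2 ≤ k) (hk : Even k) (hL : (sqShadow hk).LocalLinkage) : DiamondFilmOwnCriticalContinuity k :=
  fun v => (sqShadow hk).theta_criticalProb_eq_zero_of_localLinkage (connected hk2) (numInfiniteClusters_le_one hk2) hL v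

/-- **`DiamondFilmOwnCriticalContinuity k` FOR EVEN `k ≥ 2` FROM SHAPED LINKAGE (radius 3) of the square shadow.** Independent of p205010.
[cite: DuminilCopinSidoraviciusTassion2016, Thm. 1 and §2] [cite: BenjaminiSchramm1996, Conj. 4 / Question 3] -/
theorem diamondFilmOwnCriticalContinuity_of_shapedLinkage (hk2 : 2 ≤ k) (hk : Even k) (hL : (sqShadow hk).ShapedLinkage 3) : DiamondFilmOwnCriticalContinuity k :=
  fun v => (sqShadow hk).theta_criticalProb_eq_zero_of_shapedLinkage (connected hk2) (numInfiniteClusters_le_one hk2) hL v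

end DiamondFilm

end Summit.CriticalPhenomena.PercolationContinuityZ3.Theorems.Transplant

end
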